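import Mathlib
import Summits.Ventures.PercRepro2.LastVertex
import Summits.Ventures.PercRepro2.ReimerWeighted

/-!
# The percolation form of the three-point inequality; conditional BK for one target (PercRepro2, mine-1)

Via the last-vertex lemma (`LastVertex.lean`) the abstract three-point inequality
`ReimerCube.three_point_weighted` specialises to connection events of a root, for every finite
multigraph and every weight vector `p ∈ [0,1]^E`:

* `three_point_conn`:
  `P({s↔a}∘{s↔b}, s↔t) + P(s↔a, s↔t)·P(s↔b, s↔t) ≤ P(s↔a, s↔t)·P(s↔b) + P(s↔a)·P(s↔b, s↔t)`
  (MINE-1.md Corollary 16.8, percolation form);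
* `disjoint_same_target_cond` (row M1-R2c): `P({s↔a}∘{s↔a}, s↔t)·P(s↔t) ≤ P(s↔a, s↔t)²` — the
  BK inequality for two edge-disjoint paths to the *same* target survives conditioning on `s ↔ t`
  (last-vertex lemma + BK + Harris).

The bridge `prob_eq_sum_wt` identifies typer-1's `prob p` on `Config E = E → Bool` with the
product weights `ReimerCube.wt Finset.univ p` on `Finset E`; `bk_weighted` is the plain BK
inequality for product weights (from `bk_union_decr_weighted`).
-/

namespace Summit.Ventures.PercRepro2

/-! ## Bridge: `prob p` on `Config E` versus the product weights `wt univ p` on `Finset E` -/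

section Bridge

variable {E : Type*} [Fintype E] [DecidableEq E]

/-- `Finset E ≃ Config E` via `ofFinset`. -/
def finsetConfigEquiv : Finset E ≃ Config E where
  toFun := ofFinset
  invFun := openSet
  left_inv := openSet_ofFinset
  right_inv := ofFinset_openSet

/-- The weight of `ofFinset S` is the product weight of `S`. -/
lemma weight_ofFinset (p : E → ℝ) (S : Finset E) :
    weight p (ofFinset S) = ReimerCube.wt Finset.univ p S := by
  unfold weight ReimerCube.wt
  apply Finset.prod_congr rfl
  intro e _
  by_cases he : e ∈ S <;> simp [edgeFactor, ofFinset, he]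

/-- The probability of an event as a sum of product weights over edge sets. -/
lemma prob_eq_sum_wt (p : E → ℝ) (X : Set (Config E)) [DecidablePred (· ∈ X)] :
    prob p X = ∑ S ∈ Finset.univ.powerset.filter (fun S => ofFinset S ∈ X),
      ReimerCube.wt Finset.univ p S := by
  rw [Finset.powerset_univ, Finset.sum_filter]
  unfold prob
  rw [← Fintype.sum_equiv finsetConfigEquiv (fun S => X.indicator (weight p) (ofFinset S))
    (fun ω => X.indicator (weight p) ω) (fun _ => rfl)]
  apply Finset.sum_congr rfl
  intro S _
  by_cases h : ofFinset S ∈ X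
  · simp [h, weight_ofFinset]
  · simp [h]

open Classical in
/-- **BK for product weights** (from `bk_union_decr_weighted` with equal pairs):
`P(X ∘ Y) ≤ P(X) · P(Y)` for increasing `X`, `Y`. -/
theorem bk_weighted (p : E → ℝ) (hp : ∀ i, 0 ≤ p i ∧ p i ≤ 1) (X Y : Finset E → Prop)
    (hX : ReimerCube.Incr X) (hY : ReimerCube.Incr Y) :
    (∑ S ∈ Finset.univ.powerset.filter (fun S => ReimerCube.DOcc X Y S), ReimerCube.wt Finset.univ p S)
      ≤ (∑ S ∈ Finset.univ.powerset.filter X, ReimerCube.wt Finset.univ p S)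
        * (∑ S ∈ Finset.univ.powerset.filter Y, ReimerCube.wt Finset.univ p S) := by
  have h := ReimerCube.bk_union_decr_weighted Finset.univ p hp X X Y Y (fun _ => True) hX hX hY hY
    (fun _ _ _ h => h) (fun _ h => h) (fun _ h => h)
  rw [ReimerCube.sum_wt, mul_one] at h
  refine le_trans (le_of_eq ?_) (h.trans (le_of_eq ?_))
  · apply Finset.sum_congr
    · ext S
      simp only [Finset.mem_filter, or_self, and_true]
    · intros; rfl
  · rw [Finset.sum_mul_sum, ← Finset.sum_product']
    apply Finset.sum_congr
    · ext q
      simp only [Finset.mem_filter, Finset.mem_product, or_self, and_true]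
      tauto
    · intros; rfl

end Bridge

/-! ## The percolation form of the three-point inequality; conditional BK for one target -/

section Percolation

variable {V : Type*} {E : Type*} [Fintype E] [DecidableEq E]

omit [Fintype E] in
/-- The connection events of a root, as increasing predicates on edge sets: `{s ↔ a}`. -/
lemma incr_carries (ends : E → Sym2 V) (s a : V) :
    ReimerCube.Incr (fun S : Finset E => Carries ends S s a) :=
  fun _ _ h hS => Carries.mono h hS

/-- Sums of product weights over filters with (propositionally) the same predicate agree, whatever
the decidability instances. -/
lemma sum_filter_congr_pred {p : E → ℝ} {P Q : Finset E → Prop} {dP : DecidablePred P}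
    {dQ : DecidablePred Q} (h : ∀ S, P S ↔ Q S) :
    ∑ S ∈ @Finset.filter _ P dP Finset.univ.powerset, ReimerCube.wt Finset.univ p S
      = ∑ S ∈ @Finset.filter _ Q dQ Finset.univ.powerset, ReimerCube.wt Finset.univ p S := by
  apply Finset.sum_congr
  · ext S
    simp only [Finset.mem_filter]
    exact and_congr_right fun _ => h S
  · intros; rfl

open Classical in
/-- **Three-point inequality for a root, percolation form** (MINE-1.md Corollary 16.8).  For every
finite multigraph, every weight vector `p ∈ [0,1]^E` and vertices `s, t, a, b`:
`P({s↔a}∘{s↔b}, s↔t) + P(s↔a, s↔t)·P(s↔b, s↔t) ≤ P(s↔a, s↔t)·P(s↔b) + P(s↔a)·P(s↔b, s↔t)`. -/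
theorem three_point_conn (p : E → ℝ) (hp : IsProbVec p) (ends : E → Sym2 V) (s t a b : V) :
    prob p (disjointConnEvent ends s a b ∩ connEvent ends s t)
      + prob p (connEvent ends s a ∩ connEvent ends s t)
          * prob p (connEvent ends s b ∩ connEvent ends s t)
    ≤ prob p (connEvent ends s a ∩ connEvent ends s t) * prob p (connEvent ends s b)
      + prob p (connEvent ends s a) * prob p (connEvent ends s b ∩ connEvent ends s t) := by
  have hp' : ∀ i, 0 ≤ p i ∧ p i ≤ 1 := fun i => ⟨hp.nonneg i, hp.le_one i⟩
  have key := ReimerCube.three_point_weighted Finset.univ p hp'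
    (fun S => Carries ends S s a) (fun S => Carries ends S s b) (fun S => Carries ends S s t)
    (incr_carries ends s a) (incr_carries ends s b) (incr_carries ends s t)
  -- the left-hand probability is dominated by the weighted union sum
  have hL : prob p (disjointConnEvent ends s a b ∩ connEvent ends s t)
      ≤ ∑ S ∈ Finset.univ.powerset.filter
          (fun S => ReimerCube.DOcc (fun T => Carries ends T s a ∧ Carries ends T s t)
              (fun T => Carries ends T s b) S ∨
            ReimerCube.DOcc (fun T => Carries ends T s a)
              (fun T => Carries ends T s b ∧ Carries ends T s t) S),
          ReimerCube.wt Finset.univ p S := by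
    rw [prob_eq_sum_wt]
    apply Finset.sum_le_sum_of_subset_of_nonneg
    · intro S hS
      rw [Finset.mem_filter] at hS ⊢
      refine ⟨hS.1, ?_⟩
      rcases disjointConnEvent_inter_connEvent_subset ends s t a b hS.2 with
        ⟨K, L, hKL, hK, hL, hKa, hKt, hLb⟩ | ⟨K, L, hKL, hK, hL, hKa, hLb, hLt⟩
      · left
        refine ⟨K, L, fun e he => ofFinset_eq_true_iff.1 (hK e he),
          fun e he => ofFinset_eq_true_iff.1 (hL e he), hKL, ?_, ?_⟩
        · intro T hT; exact ⟨Carries.mono hT hKa, Carries.mono hT hKt⟩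
        · intro T hT; exact Carries.mono hT hLb
      · right
        refine ⟨K, L, fun e he => ofFinset_eq_true_iff.1 (hK e he),
          fun e he => ofFinset_eq_true_iff.1 (hL e he), hKL, ?_, ?_⟩
        · intro T hT; exact Carries.mono hT hKa
        · intro T hT; exact ⟨Carries.mono hT hLb, Carries.mono hT hLt⟩
    · intro S _ _
      exact ReimerCube.wt_nonneg Finset.univ p hp' S
  -- the other four probabilities are the corresponding weighted sums
  have eAC : prob p (connEvent ends s a ∩ connEvent ends s t)
      = ∑ S ∈ Finset.univ.powerset.filter (fun S => Carries ends S s a ∧ Carries ends S s t),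
          ReimerCube.wt Finset.univ p S := by
    rw [prob_eq_sum_wt]; exact sum_filter_congr_pred fun _ => Iff.rfl
  have eBC : prob p (connEvent ends s b ∩ connEvent ends s t)
      = ∑ S ∈ Finset.univ.powerset.filter (fun S => Carries ends S s b ∧ Carries ends S s t),
          ReimerCube.wt Finset.univ p S := by
    rw [prob_eq_sum_wt]; exact sum_filter_congr_pred fun _ => Iff.rfl
  have eA : prob p (connEvent ends s a)
      = ∑ S ∈ Finset.univ.powerset.filter (fun S => Carries ends S s a),
          ReimerCube.wt Finset.univ p S := by
    rw [prob_eq_sum_wt]; exact sum_filter_congr_pred fun _ => Iff.rfl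
  have eB : prob p (connEvent ends s b)
      = ∑ S ∈ Finset.univ.powerset.filter (fun S => Carries ends S s b),
          ReimerCube.wt Finset.univ p S := by
    rw [prob_eq_sum_wt]; exact sum_filter_congr_pred fun _ => Iff.rfl
  rw [eAC, eBC, eA, eB]
  linarith [hL, key]

open Classical in
/-- **Conditional BK for two edge-disjoint paths to one target** (row M1-R2c, a theorem): for every
finite multigraph, every weight vector and vertices `s, t, a`,
`P({s↔a}∘{s↔a}, s↔t) · P(s↔t) ≤ P(s↔a, s↔t)²`.
Proof: by the last-vertex lemma `{s↔a}∘{s↔a} ∩ {s↔t} ⊆ ({s↔a}∩{s↔t}) ∘ {s↔a}`, BK bounds this by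
`P(s↔a, s↔t)·P(s↔a)`, and Harris gives `P(s↔a)·P(s↔t) ≤ P(s↔a, s↔t)`. -/
theorem disjoint_same_target_cond (p : E → ℝ) (hp : IsProbVec p) (ends : E → Sym2 V)
    (s t a : V) :
    prob p (disjointConnEvent ends s a a ∩ connEvent ends s t) * prob p (connEvent ends s t)
      ≤ prob p (connEvent ends s a ∩ connEvent ends s t) ^ 2 := by
  have hp' : ∀ i, 0 ≤ p i ∧ p i ≤ 1 := fun i => ⟨hp.nonneg i, hp.le_one i⟩
  -- step 1: P(A∘A ∩ C) ≤ P(A ∩ C) · P(A)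
  have hBK := bk_weighted p hp' (fun S => Carries ends S s a ∧ Carries ends S s t)
    (fun S => Carries ends S s a)
    (fun _ _ h hS => ⟨Carries.mono h hS.1, Carries.mono h hS.2⟩) (incr_carries ends s a)
  have hL : prob p (disjointConnEvent ends s a a ∩ connEvent ends s t)
      ≤ ∑ S ∈ Finset.univ.powerset.filter
          (fun S => ReimerCube.DOcc (fun T => Carries ends T s a ∧ Carries ends T s t)
              (fun T => Carries ends T s a) S),
          ReimerCube.wt Finset.univ p S := by
    rw [prob_eq_sum_wt]
    apply Finset.sum_le_sum_of_subset_of_nonneg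
    · intro S hS
      rw [Finset.mem_filter] at hS ⊢
      refine ⟨hS.1, ?_⟩
      rcases disjointConnEvent_inter_connEvent_subset ends s t a a hS.2 with
        ⟨K, L, hKL, hK, hL, hKa, hKt, hLb⟩ | ⟨K, L, hKL, hK, hL, hKa, hLb, hLt⟩
      · refine ⟨K, L, fun e he => ofFinset_eq_true_iff.1 (hK e he),
          fun e he => ofFinset_eq_true_iff.1 (hL e he), hKL, ?_, ?_⟩
        · intro T hT; exact ⟨Carries.mono hT hKa, Carries.mono hT hKt⟩
        · intro T hT; exact Carries.mono hT hLb
      · refine ⟨L, K, fun e he => ofFinset_eq_true_iff.1 (hL e he),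
          fun e he => ofFinset_eq_true_iff.1 (hK e he), hKL.symm, ?_, ?_⟩
        · intro T hT; exact ⟨Carries.mono hT hLb, Carries.mono hT hLt⟩
        · intro T hT; exact Carries.mono hT hKa
    · intro S _ _
      exact ReimerCube.wt_nonneg Finset.univ p hp' S
  have h1 : prob p (disjointConnEvent ends s a a ∩ connEvent ends s t)
      ≤ prob p (connEvent ends s a ∩ connEvent ends s t) * prob p (connEvent ends s a) := by
    refine hL.trans (hBK.trans (le_of_eq ?_))
    rw [prob_eq_sum_wt, prob_eq_sum_wt]
    refine congrArg₂ (· * ·) ?_ ?_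
    · exact sum_filter_congr_pred fun _ => Iff.rfl
    · exact sum_filter_congr_pred fun _ => Iff.rfl
  -- step 2: Harris
  have h2 : prob p (connEvent ends s a) * prob p (connEvent ends s t)
      ≤ prob p (connEvent ends s a ∩ connEvent ends s t) :=
    prob_mul_prob_le_prob_inter hp (isUpperSet_connEvent ends s a) (isUpperSet_connEvent ends s t)
  have hC : 0 ≤ prob p (connEvent ends s t) := prob_nonneg hp _
  have hAC : 0 ≤ prob p (connEvent ends s a ∩ connEvent ends s t) := prob_nonneg hp _
  calc prob p (disjointConnEvent ends s a a ∩ connEvent ends s t) * prob p (connEvent ends s t)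
      ≤ prob p (connEvent ends s a ∩ connEvent ends s t) * prob p (connEvent ends s a)
          * prob p (connEvent ends s t) := by
        exact mul_le_mul_of_nonneg_right h1 hC
    _ = prob p (connEvent ends s a ∩ connEvent ends s t)
          * (prob p (connEvent ends s a) * prob p (connEvent ends s t)) := by ring
    _ ≤ prob p (connEvent ends s a ∩ connEvent ends s t)
          * prob p (connEvent ends s a ∩ connEvent ends s t) :=
        mul_le_mul_of_nonneg_left h2 hAC
    _ = prob p (connEvent ends s a ∩ connEvent ends s t) ^ 2 := by ring

end Percolation

end Summit.Ventures.PercRepro2
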